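import Mathlib
import Summits.QuantumFields.BalabanUV.Beta.CovariantPlateauBlocksPairCurl

/-!
# Beta / CovariantPlateauBlocksPairExp335 — THE TWO-TRANSPORT E-I3 MODEL END FROM THE (3.35) SHAPE IN ITS PRINTED,
# EXPONENTIAL FORM: gauged bond transporters `u_b = e^{E_b}` with `‖E_b‖ ≤ s` (print's `|A| < O(1)Mα₀(L^jη)^{−1}`, `E_b = iηA(b)`)
# and ORDINARY lattice differences `‖E_{b+e_μ} − E_b‖ ≤ δ` across in-block plaquettes (print's `|∇^ηA| < O(1)Mα₀(L^jη)^{−2}`,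
# `E_{b+e_μ} − E_b = iη²(∇^η_μ A_κ)(x)`) ⟹ this unit's `CovariantPlateauBlocksPairCurl` hypotheses with `a = s·e^s`,
# `f = δ·e^s` (b09-g7's exponential estimates BY NAME) ⟹ beta-d4-p2's two-transport END (p223754) with `α = 2δe^s + 2(se^s)²`;
# arithmetic `s ≤ C∕n, δ ≤ C∕n² ⟹ n²α ≤ 2C′(1+C′)`, `C′ = C·e^C` (unit `b2b-balaban-beta-d4-p3`, GEN 7, row-D4 co-owner #3,
# road P3 «reduction road»; sequel of claim «E-I3-COV-PAIR-CURL» journal l.16539, landing l.16775)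

HONEST FRAMING (cell rule).  Discharging `BetaPertH` makes Bałaban's UV stability UNCONDITIONAL — a real constructive-QFT
result; NOT the continuum limit, NOT the Clay problem.  HONEST DEPENDENCY (verbatim): «continuum YM on T⁴ ⇐ BetaPertH ∧ nine
spine estimates (0/9 proved); BetaPertH ⇐ (D1) ∧ (D4) ∧ CAP+tail; G-an2-4 gates asym, D1 and NE2/3/4.»  THIS MODULE DISCHARGES
NOTHING of `BetaPertH`, asserts NOTHING printed and cites nothing as a fact (ABSOLUTE RULE): [folklore] Banach-algebra
estimates (b09-g7's `B9Eq335Plaquette.norm_exp_sub_one_le_mul`, `norm_exp_sub_exp_le_of_le`, from the tree's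
`Literature.Analysis.Complex` exponential lemmas) and real arithmetic, about beta-d4-p2's MODEL (blocks, gluings, orthogonal
transporters `W` and block gauges `g` as DATA; the Lie-algebra elements `E` are DATA too).  WHY THIS FILE: the sibling
`CovariantPlateauBlocksPairCurl` (p225037) states the `|∇^ηA|`-half as a bound on differences of parallel gauged bond
TRANSPORTERS (the «covariant reading»); print's (3.35) — [B9] = `Balaban1985BackgroundPropagators` p. 396, READ AS IMAGE
2026-08-20 by this seat: «there exists a gauge transformation u on □ such that U^u = e^{iηA}, and if the index of □ is j, then
|A| < O(1)Mα₀(L^jη)^{−1}, |∇^ηA| < O(1)Mα₀(L^jη)^{−2} on □» — is a bound on the Lie-algebra field `A` and its ORDINARY lattice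
gradient.  Here the hypothesis is stated in exactly that form (`hexp`, `hs`, `hδ`), so NO reading is interposed between the
display and the MODEL hypothesis: the dictionary is `E_b := iηA(b)` (complexified), `s := η·O(1)Mα₀(L^jη)^{−1} = C∕n`,
`δ := η²·O(1)Mα₀(L^jη)^{−2} = C∕n²` (`n = L^j`, `C = O(1)Mα₀`).  (3.35) is a HYPOTHESIS of B9's Theorem 3.1; that
Bałaban's backgrounds satisfy it is B8–B10∕the T⁴ spine's business, not row D4's.  No class change on row D4 or G-B9-15
(width 0; D4 DISCHARGE NO DATE); NOT BetaPertH, NOT continuum, NOT Clay, NOT summit progress.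

CONTENT (kernel, 0 sorry).  §1 **`h335A_of_exp`** (`‖u_b − 1‖ ≤ s·e^s`), **`h335F_of_exp`** (`‖u_{b+e_μ} − u_b‖ ≤ δ·e^s`).
§2 ENDs **`coarse_coercive_plateau_blocks_pair_exp335`** (every monotone contour family `ω`) and
**`coarse_coercive_plateau_blocks_nested_exp335`** ((3.55) chains) = the sibling's `…_pair_curl` with `a = s·e^s`, `f = δ·e^s`.
§3 arithmetic **`dict_exp_le`** (`s ≤ C∕n ⟹ s·e^s ≤ (C·e^C)∕n`, `δ ≤ C∕n² ⟹ δ·e^s ≤ (C·e^C)∕n²`) and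
**`nsq_alpha_exp_le`** (`n²·(2δe^s + 2(se^s)²) ≤ 2C′(1+C′)`, `C′ = C·e^C`) — so the sibling's `eps_mixed_le`∕`thin_times_n_le`
apply with `C′`.  §4 non-vacuity (flat `W`, trivial gauge, `E ≡ 0`: `e^0 = 1`, `s = δ = 0`, constant `1∕54`).
-/

namespace Summit.QuantumFields.BalabanUV.Beta.CovariantPlateauBlocksPairExp335

open scoped BigOperators Matrix Matrix.Norms.L2Operator
open Finset
open Literature.MathematicalPhysics.QuantumFieldTheory.Balaban1983to89.B5Prop11Lower (nsq nsq_nonneg)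
open Literature.MathematicalPhysics.QuantumFieldTheory.Balaban1983to89.B7Prop1Explicit
open Literature.MathematicalPhysics.QuantumFieldTheory.Balaban1983to89 (B9Eq335Plaquette.norm_exp_sub_one_le_mul
  B9Eq335Plaquette.norm_exp_sub_exp_le_of_le)
open Summit.QuantumFields.BalabanUV.Beta.AccretiveCombesThomasSandwich (sandwich)
open Summit.QuantumFields.BalabanUV.Beta.CoarseCoerciveTransport (covFamily)
open Summit.QuantumFields.BalabanUV.Beta.CoarseCoerciveCovariantEnergy (covDiff)
open Summit.QuantumFields.BalabanUV.Beta.CoarseCoerciveBlock1D (gramForm)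
open Summit.QuantumFields.BalabanUV.Beta.ThinLoopHolonomy
open Summit.QuantumFields.BalabanUV.Beta.MonotoneLoopHolonomy
open Summit.QuantumFields.BalabanUV.Beta.CovariantPlateauBlocks
open Summit.QuantumFields.BalabanUV.Beta.CovariantPlateauBlocksEnd
open Summit.QuantumFields.BalabanUV.Beta.CovariantPlateauBlocksPair
open Summit.QuantumFields.BalabanUV.Beta.CovariantPlateauBlocksPairCurl

noncomputable section

/-! ## §1 From the exponential form of the gauged bonds to the sibling's (h335A), (h335F) -/

section ExpForm

variable {Y : Type*} {Cp : Type*} [Fintype Cp] [DecidableEq Cp] [Nonempty Cp] {ν n : ℕ}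
variable (W : Bond Y ν n → Matrix Cp Cp ℝ) (g : Y → Off ν n → Matrix Cp Cp ℝ)

/-- **THE `|A|`-HALF**: if every in-block gauged bond transporter is `e^{E_b}` with `‖E_b‖ ≤ s`, then `‖u_b − 1‖ ≤ s·e^s`
(`‖e^X − 1‖ ≤ ‖X‖e^{‖X‖}`, b09-g7). [cite: Balaban1985BackgroundPropagators, (3.35) p.396] -/
theorem h335A_of_exp (E : Y → Off ν n → Fin ν → Matrix Cp Cp ℂ) {s : ℝ}
    (hexp : ∀ (y : Y) (v : Off ν n) (κ : Fin ν) (h : (v κ : ℕ) + 1 < n),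
      cpxHom (g y v * W ((y, v), κ) * (g y (succOff v κ h))ᵀ) = NormedSpace.exp (E y v κ))
    (hs : ∀ y v κ, ‖E y v κ‖ ≤ s) (y : Y) (v : Off ν n) (κ : Fin ν) (h : (v κ : ℕ) + 1 < n) :
    ‖cpxHom (g y v * W ((y, v), κ) * (g y (succOff v κ h))ᵀ) - 1‖ ≤ s * Real.exp s := by
  rw [hexp]
  have h0 : 0 ≤ s := (norm_nonneg _).trans (hs y v κ)
  refine (B9Eq335Plaquette.norm_exp_sub_one_le_mul (E y v κ)).trans ?_
  exact mul_le_mul (hs y v κ) (Real.exp_le_exp.mpr (hs y v κ)) (Real.exp_pos _).le h0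

/-- **THE `|∇^ηA|`-HALF (ordinary lattice gradient, as printed)**: if moreover `‖E_{b+e_μ} − E_b‖ ≤ δ` for the two in-block
bonds parallel to `e_κ` across a plaquette, then `‖u_{b+e_μ} − u_b‖ ≤ δ·e^s` (`‖e^X − e^Y‖ ≤ ‖X − Y‖e^{max ‖·‖}`, b09-g7).
[cite: Balaban1985BackgroundPropagators, (3.35) p.396] -/
theorem h335F_of_exp (E : Y → Off ν n → Fin ν → Matrix Cp Cp ℂ) {s δ : ℝ}
    (hexp : ∀ (y : Y) (v : Off ν n) (κ : Fin ν) (h : (v κ : ℕ) + 1 < n),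
      cpxHom (g y v * W ((y, v), κ) * (g y (succOff v κ h))ᵀ) = NormedSpace.exp (E y v κ))
    (hs : ∀ y v κ, ‖E y v κ‖ ≤ s)
    (hδ : ∀ (y : Y) (v : Off ν n) (κ μ : Fin ν) (hμ : (v μ : ℕ) + 1 < n), ‖E y (succOff v μ hμ) κ - E y v κ‖ ≤ δ)
    (y : Y) (v : Off ν n) (κ μ : Fin ν) (hκ : (v κ : ℕ) + 1 < n) (hμ : (v μ : ℕ) + 1 < n)
    (hκ' : ((succOff v μ hμ) κ : ℕ) + 1 < n) :
    ‖cpxHom (g y (succOff v μ hμ) * W ((y, succOff v μ hμ), κ) * (g y (succOff (succOff v μ hμ) κ hκ'))ᵀ) -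
        cpxHom (g y v * W ((y, v), κ) * (g y (succOff v κ hκ))ᵀ)‖ ≤ δ * Real.exp s := by
  rw [hexp, hexp]
  refine (B9Eq335Plaquette.norm_exp_sub_exp_le_of_le _ _ (hs y _ κ) (hs y v κ)).trans ?_
  exact mul_le_mul_of_nonneg_right (hδ y v κ μ hμ) (Real.exp_pos _).le

end ExpForm

/-! ## §2 The two-transport ENDs from the exponential (3.35) shape -/

section End

variable {Y : Type*} [Fintype Y] [DecidableEq Y] {Cp : Type*} [Fintype Cp] [DecidableEq Cp] [Nonempty Cp] {ν n w : ℕ}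
variable [NeZero n] (W : Bond Y ν n → Matrix Cp Cp ℝ) (hW : ∀ b, (W b)ᵀ * W b = 1) (ω : Off ν n → List (Fin ν))

/-- **E-I3 WITH TWO TRANSPORTS, MODEL INSTANCE, FROM (3.35) IN ITS PRINTED FORM.**  Blocks of side `n`, any gluing, any fibre,
orthogonal `W`, any monotone contour family `ω` for the average (bumps on the tree transports); a per-block orthogonal gauge
`g` in which `u_b = e^{E_b}`, `‖E_b‖ ≤ s`, `‖E_{b+e_μ} − E_b‖ ≤ δ` (in-block); with `a := s·e^s`, `f := δ·e^s`, `α := 2f + 2a²`,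
`ε := (ν(n−1) choose 2)·α < 1`, `H := ν(n−1)·α`:
`((1 − ε)((n−2w)∕n)^ν)² ∕ (μ₀·n^ν + (1∕w + H)(νn^ν(1∕w + H)))·‖B‖² ≤ Re B*(Q̃_ω A_W⁻¹ Q̃_ωᵀ)B` — the sibling's
`coarse_coercive_plateau_blocks_pair_curl` BY NAME. [cite: Balaban1985BackgroundPropagators, (3.35) p.396, (3.19) p.393, (3.55) p.401] -/
theorem coarse_coercive_plateau_blocks_pair_exp335 (σ : Fin ν → Y → Y) (g : Y → Off ν n → Matrix Cp Cp ℝ)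
    (hg : ∀ y v, (g y v)ᵀ * g y v = 1) (hω : ∀ v, disp (posWord (ω v)) = emb v) (hw : 0 < w) (h2w : 2 * w < n)
    {μ0 : ℝ} (hμ0 : 0 < μ0) (E : Y → Off ν n → Fin ν → Matrix Cp Cp ℂ) {s δ : ℝ} (hδ0 : 0 ≤ δ)
    (hexp : ∀ (y : Y) (v : Off ν n) (κ : Fin ν) (h : (v κ : ℕ) + 1 < n),
      cpxHom (g y v * W ((y, v), κ) * (g y (succOff v κ h))ᵀ) = NormedSpace.exp (E y v κ))
    (hs : ∀ y v κ, ‖E y v κ‖ ≤ s)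
    (hδ : ∀ (y : Y) (v : Off ν n) (κ μ : Fin ν) (hμ : (v μ : ℕ) + 1 < n), ‖E y (succOff v μ hμ) κ - E y v κ‖ ≤ δ)
    (hε : ((ν * (n - 1)).choose 2 : ℕ) * (2 * (δ * Real.exp s) + 2 * (s * Real.exp s) ^ 2) < 1) (B : Y × Cp → ℂ) :
    ((1 - ((ν * (n - 1)).choose 2 : ℕ) * (2 * (δ * Real.exp s) + 2 * (s * Real.exp s) ^ 2)) *
          (((n : ℝ) - 2 * w) / n) ^ ν) ^ 2 /
        (μ0 * (1 * (n : ℝ) ^ ν) + (1 / w + ν * ((n : ℝ) - 1) * (2 * (δ * Real.exp s) + 2 * (s * Real.exp s) ^ 2)) *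
          (ν * (n : ℝ) ^ ν * (1 / w + ν * ((n : ℝ) - 1) * (2 * (δ * Real.exp s) + 2 * (s * Real.exp s) ^ 2)))) *
        nsq B ≤
      (star B ⬝ᵥ (sandwich (gramForm μ0 (covDiff bsrc (btgt σ) W)) (covFamily sB (RgenFam W hW ω)) *ᵥ B)).re :=
  coarse_coercive_plateau_blocks_pair_curl W hW ω σ g hg hω hw h2w hμ0
    (mul_nonneg hδ0 (Real.exp_pos s).le) hε (h335A_of_exp W g E hexp hs) (h335F_of_exp W g E hexp hs hδ) B

/-- **… FOR THE RECURSIVE CHAINS OF (3.55)** (nested block base points, any `L`, any depth `m`).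
[cite: Balaban1985BackgroundPropagators, (3.35) p.396, (3.55) p.401] -/
theorem coarse_coercive_plateau_blocks_nested_exp335 (σ : Fin ν → Y → Y) (L m : ℕ)
    (g : Y → Off ν n → Matrix Cp Cp ℝ) (hg : ∀ y v, (g y v)ᵀ * g y v = 1) (hw : 0 < w) (h2w : 2 * w < n)
    {μ0 : ℝ} (hμ0 : 0 < μ0) (E : Y → Off ν n → Fin ν → Matrix Cp Cp ℂ) {s δ : ℝ} (hδ0 : 0 ≤ δ)
    (hexp : ∀ (y : Y) (v : Off ν n) (κ : Fin ν) (h : (v κ : ℕ) + 1 < n),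
      cpxHom (g y v * W ((y, v), κ) * (g y (succOff v κ h))ᵀ) = NormedSpace.exp (E y v κ))
    (hs : ∀ y v κ, ‖E y v κ‖ ≤ s)
    (hδ : ∀ (y : Y) (v : Off ν n) (κ μ : Fin ν) (hμ : (v μ : ℕ) + 1 < n), ‖E y (succOff v μ hμ) κ - E y v κ‖ ≤ δ)
    (hε : ((ν * (n - 1)).choose 2 : ℕ) * (2 * (δ * Real.exp s) + 2 * (s * Real.exp s) ^ 2) < 1) (B : Y × Cp → ℂ) :
    ((1 - ((ν * (n - 1)).choose 2 : ℕ) * (2 * (δ * Real.exp s) + 2 * (s * Real.exp s) ^ 2)) *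
          (((n : ℝ) - 2 * w) / n) ^ ν) ^ 2 /
        (μ0 * (1 * (n : ℝ) ^ ν) + (1 / w + ν * ((n : ℝ) - 1) * (2 * (δ * Real.exp s) + 2 * (s * Real.exp s) ^ 2)) *
          (ν * (n : ℝ) ^ ν * (1 / w + ν * ((n : ℝ) - 1) * (2 * (δ * Real.exp s) + 2 * (s * Real.exp s) ^ 2)))) *
        nsq B ≤
      (star B ⬝ᵥ (sandwich (gramForm μ0 (covDiff bsrc (btgt σ) W))
        (covFamily sB (RgenFam W hW (nestedList L m))) *ᵥ B)).re :=
  coarse_coercive_plateau_blocks_pair_exp335 W hW (nestedList L m) σ g hg (disp_posWord_nestedList L m) hw h2w hμ0 E hδ0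
    hexp hs hδ hε B

end End

/-! ## §3 The dictionary arithmetic: `s ≤ C∕n`, `δ ≤ C∕n²` ⟹ the sibling's `a ≤ C′∕n`, `f ≤ C′∕n²`, `C′ = C·e^C` -/

section Arith

/-- `s ≤ C∕n ≤ C` (`n ≥ 1`) ⟹ `s·e^s ≤ (C·e^C)∕n`. [folklore] -/
theorem dict_exp_le {C s : ℝ} {n : ℕ} (hn : 1 ≤ n) (hs0 : 0 ≤ s) (hs : s ≤ C / n) :
    s * Real.exp s ≤ C * Real.exp C / n := by
  have hn' : (1 : ℝ) ≤ n := by exact_mod_cast hn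
  have hn0 : (0 : ℝ) < n := by linarith
  have hCn : 0 ≤ C / n := hs0.trans hs
  have hC0 : 0 ≤ C := by
    have := mul_nonneg hCn hn0.le; rwa [div_mul_cancel₀ _ hn0.ne'] at this
  have hsC : s ≤ C := hs.trans (div_le_self hC0 hn')
  have h1 : s * n ≤ C := by rwa [le_div_iff₀ hn0] at hs
  rw [le_div_iff₀ hn0]
  calc s * Real.exp s * n = (s * n) * Real.exp s := by ring
    _ ≤ C * Real.exp C :=
        mul_le_mul h1 (Real.exp_le_exp.mpr hsC) (Real.exp_pos _).le hC0

/-- `δ ≤ C∕n²`, `s ≤ C∕n` ⟹ `δ·e^s ≤ (C·e^C)∕n²`. [folklore] -/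
theorem dict_exp_le_sq {C s δ : ℝ} {n : ℕ} (hn : 1 ≤ n) (hs0 : 0 ≤ s) (hs : s ≤ C / n) (hδ0 : 0 ≤ δ)
    (hδ : δ ≤ C / n ^ 2) : δ * Real.exp s ≤ C * Real.exp C / n ^ 2 := by
  have hn' : (1 : ℝ) ≤ n := by exact_mod_cast hn
  have hn0 : (0 : ℝ) < n := by linarith
  have hCn : 0 ≤ C / n := hs0.trans hs
  have hC0 : 0 ≤ C := by
    have := mul_nonneg hCn hn0.le; rwa [div_mul_cancel₀ _ hn0.ne'] at this
  have hsC : s ≤ C := hs.trans (div_le_self hC0 hn')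
  calc δ * Real.exp s ≤ C / n ^ 2 * Real.exp C :=
        mul_le_mul hδ (Real.exp_le_exp.mpr hsC) (Real.exp_pos _).le (hδ0.trans hδ)
    _ = C * Real.exp C / n ^ 2 := by ring

/-- **`n²α ≤ 2C′(1+C′)` with `C′ = C·e^C`** for the exponential dictionary `a = s·e^s`, `f = δ·e^s` — so the sibling's
`eps_mixed_le`∕`thin_times_n_le` (j-uniformity of the mixed-loop defect and of `H·n`) apply with `C′`. [folklore] -/
theorem nsq_alpha_exp_le {C s δ : ℝ} {n : ℕ} (hn : 1 ≤ n) (hs0 : 0 ≤ s) (hs : s ≤ C / n) (hδ0 : 0 ≤ δ)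
    (hδ : δ ≤ C / n ^ 2) :
    (n : ℝ) ^ 2 * (2 * (δ * Real.exp s) + 2 * (s * Real.exp s) ^ 2) ≤
      2 * (C * Real.exp C) * (1 + C * Real.exp C) := by
  have hn' : (1 : ℝ) ≤ n := by exact_mod_cast hn
  have hn0 : (0 : ℝ) < n := by linarith
  have hCn : 0 ≤ C / n := hs0.trans hs
  have hC0 : 0 ≤ C := by
    have := mul_nonneg hCn hn0.le; rwa [div_mul_cancel₀ _ hn0.ne'] at this
  exact nsq_alpha_le hn (mul_nonneg hC0 (Real.exp_pos _).le) (mul_nonneg hs0 (Real.exp_pos _).le)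
    (dict_exp_le hn hs0 hs) (dict_exp_le_sq hn hs0 hs hδ0 hδ)

end Arith

/-! ## §4 Non-vacuity -/

/-- One block of side 3 (`ν = 1`, `w = 1`, fibre `Unit`, flat `W ≡ 1`, trivial gauge, `E ≡ 0` so `u_b = 1 = e^0`, `s = δ = 0`,
`μ₀ = 1`), the (3.55)-shape contour `nestedList 2 1`: every hypothesis holds and the END gives `1∕54`. [folklore] -/
example (B : Unit × Unit → ℂ) :
    (1 / 54 : ℝ) * nsq B ≤
      (star B ⬝ᵥ (sandwich (gramForm 1 (covDiff bsrc (btgt (fun (_ : Fin 1) (_ : Unit) => ()))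
          fun _ : Bond Unit 1 3 => (1 : Matrix Unit Unit ℝ)))
        (covFamily (sB (Y := Unit) (ν := 1) (n := 3))
          (RgenFam (fun _ : Bond Unit 1 3 => (1 : Matrix Unit Unit ℝ)) flat_orth (nestedList 2 1))) *ᵥ B)).re := by
  have h := coarse_coercive_plateau_blocks_nested_exp335 (Y := Unit) (Cp := Unit) (ν := 1) (n := 3) (w := 1) (μ0 := 1)
    (s := 0) (δ := 0) (fun _ : Bond Unit 1 3 => (1 : Matrix Unit Unit ℝ)) flat_orth (fun (_ : Fin 1) (_ : Unit) => ()) 2 1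
    (fun _ _ => (1 : Matrix Unit Unit ℝ)) (fun _ _ => by simp) Nat.one_pos (by norm_num) one_pos
    (fun _ _ _ => (0 : Matrix Unit Unit ℂ)) le_rfl
    (fun y v κ h => by rw [NormedSpace.exp_zero]; simp) (fun _ _ _ => by simp) (fun _ _ _ _ _ => by simp) (by norm_num) B
  convert h using 2
  norm_num

end

end Summit.QuantumFields.BalabanUV.Beta.CovariantPlateauBlocksPairExp335
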